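import Literature.Computability.Complexity.FourierDegree
import Literature.Computability.Complexity.HuangMatrix
import HarnessLib

/-!
# Huang's theorem in spectral form: `√deg(f) ≤ λ(f)` (as a Rayleigh-quotient certificate)

H. Huang, *Induced subgraphs of hypercubes and a proof of the Sensitivity Conjecture*, Ann. of
Math. 190 (2019), Thm. 1.1 / Thm. 1.4, in the strengthened reading of Aaronson–Ben-David–Kothari–
Rao–Tal (STOC 2021, §1 and §3, Thm. "Huang"): "For all Boolean functions `f : {0,1}ⁿ → {0,1}`, we
have `deg(f) ≤ λ(f)²`", where `λ(f) = ‖A_f‖` is the spectral norm of the adjacency matrix of the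
sensitivity graph `G_f` (edges `(x, x^i)` with `f(x) ≠ f(x^i)`).

Their proof exhibits a nonnegative vector `v' ≠ 0` with `(A_f v')_x ≥ √deg(f) · v'_x` for every
`x` ("we claim that `‖A_f · v'‖ ≥ √n · ‖v'‖`. To see so, note that for every `x ∈ V₀` we have
`(A_f v')_x = ∑_{y∼x, y∈V₀} v'_y = ∑_{y∼x} v'_y ≥ |∑_y B_{x,y} v_y| = √n |v_x| = √n v'_x`. On the
other hand, for `x ∈ V₁` we have `(A_f v')_x = 0 = v'_x`"), which is all that is ever used of
`λ(f)`. We prove exactly this certificate, normalised (`huang_degree_pointwise`):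

  `∃ δ ≥ 0, ∑_x δ_x² = 1, ∀ x, √deg(f) · δ_x ≤ ∑_{i : f(x) ≠ f(x^i)} δ_{x^i}`,

with `deg = booleanDegree` (`FourierDegree.lean`) and `x^i = flipBlock x {i}`. Summing against
`δ_x` gives `√deg(f) ≤ ∑_{(x,x^i) sensitive} δ_x δ_{x^i} ≤ λ(f)`; combined with the adversary
bound of `QuantumComplexity/SpectralAdversary.lean` this is ABKRT's Thm. 2, `deg(f) = O(Q(f)²)`.

**Proof** (ABKRT §3 with the tree's `HuangMatrix.lean`). "Without loss of generality we can
assume that `deg(f) = n` since otherwise we can restrict our attention to a subcube … choose any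
monomial … of degree `deg(f)` and set all the variables not appearing in this monomial to `0`":
take a maxonomial `S₀` (`exists_maxonomial`) and the restriction `f' = f|_{S₀ᶜ ← 0}`, whose
coefficient at `S₀` is still nonzero (`cubeFourierCoeff_piecewise_of_maxonomial`). "Let
`V₀ = {x : f(x) = Parity(x)}` and `V₁ = {x : f(x) ≠ Parity(x)}`. By the fact that `deg(f) = n` we
know that `|V₀| ≠ |V₁|`" (`parityClass`, `card_parityClass_sub`: `|V₀| - |V₁| = -2^{N+1} f̂'(S₀)`);
"any edge … between `V₀` and `V₀` is an edge in `G_f`" (`parityClass_sensitive`); the larger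
class has `> 2^{N-1}` points, so `exists_eigenvector_vanishing_off` (`HuangMatrix.lean`) gives
`v ≠ 0` supported in it with `B v = √n v`; the displayed inequality follows with `|ε| = 1`. Since
we work on the whole cube `{0,1}ᴺ` with directions `S₀` (rather than on `{0,1}^{S₀}`), the vector
is finally transported to the subcube through `x ↦ x|_{S₀ᶜ ← τ}` (`transportVec`), where `f'`
agrees with `f`. The proof-specific objects (`parityClass`, `transportVec`, …) live in the
sub-namespace `Huang`; only `huang_degree_pointwise` and two general lemmas are directory-level.

## References

* H. Huang, Ann. of Math. 190 (2019) (arXiv:1907.00847), Thm. 1.1, Thm. 1.4, Lemma 2.2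
  [Huang2019].
* S. Aaronson, S. Ben-David, R. Kothari, S. Rao, A. Tal, STOC 2021 (arXiv:2010.12629), §3,
  Thm. "Huang" (= their restatement `deg(f) ≤ λ(f)²`) and its proof [AaronsonBenDavidKothariRaoTal2021].
-/

noncomputable section

namespace Literature.Computability.Complexity

open Finset LowDegree Literature.Probability.RandomGraphs.LowDegree

variable {N : ℕ}

/-! ### Two general lemmas -/

/-- A maxonomial exists as soon as the degree is positive (variant of `exists_maxonomial` of
`FourierDegree.lean`). [cite: Midrijanis2004, §3] -/
theorem exists_maxonomial_of_pos {g : (Fin N → Bool) → ℝ} (h : 0 < fourierDegree g) :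
    ∃ S : Finset (Fin N), S.Nonempty ∧ cubeFourierCoeff g S ≠ 0 ∧ S.card = fourierDegree g := by
  classical
  have hne : (Finset.univ.filter fun S : Finset (Fin N) => cubeFourierCoeff g S ≠ 0).Nonempty := by
    by_contra hc
    rw [Finset.not_nonempty_iff_eq_empty] at hc
    have : fourierDegree g = 0 := by rw [fourierDegree, hc, Finset.sup_empty, bot_eq_zero]
    omega
  obtain ⟨S, hS, hcard⟩ := Finset.exists_mem_eq_sup _ hne Finset.card
  have hSc : cubeFourierCoeff g S ≠ 0 := by simpa using hS
  refine ⟨S, ?_, hSc, hcard.symm⟩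
  rw [← Finset.card_pos, ← hcard]
  exact h

/-- Overriding on `J` commutes with flipping a bit outside `J`. [folklore] -/
theorem piecewise_flipBlock_singleton {J : Finset (Fin N)} {i : Fin N} (hi : i ∉ J)
    (a x : Fin N → Bool) : J.piecewise a (flipBlock x {i}) = flipBlock (J.piecewise a x) {i} := by
  classical
  funext j
  by_cases hj : j ∈ J
  · have hji : j ≠ i := fun h => hi (h ▸ hj)
    rw [Finset.piecewise_eq_of_mem _ _ _ hj, flipBlock_singleton_apply_of_ne _ hji,
      Finset.piecewise_eq_of_mem _ _ _ hj]
  · rw [Finset.piecewise_eq_of_notMem _ _ _ hj]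
    by_cases hji : j = i
    · subst hji
      rw [flipBlock_singleton_apply_self, flipBlock_singleton_apply_self,
        Finset.piecewise_eq_of_notMem _ _ _ hj]
    · rw [flipBlock_singleton_apply_of_ne _ hji, flipBlock_singleton_apply_of_ne _ hji,
        Finset.piecewise_eq_of_notMem _ _ _ hj]

namespace Huang

/-! ### Parity classes -/

/-- The parity classes `V_η = {x : (-1)^{g(x)} = η · χ_{S₀}(x)}` (`η = ±1`): for `η = -1` this is
ABKRT's `V₀ = {x : g(x) = Parity_{S₀}(x)}`, for `η = 1` their `V₁`. [cite:
AaronsonBenDavidKothariRaoTal2021, §3 (proof of Thm. "Huang")] -/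
def parityClass (g : (Fin N → Bool) → Bool) (S₀ : Finset (Fin N)) (η : ℝ) :
    Finset (Fin N → Bool) :=
  Finset.univ.filter fun x => sgn (g x) = η * walsh S₀ x

/-- Membership in a parity class. [folklore] -/
theorem mem_parityClass {g : (Fin N → Bool) → Bool} {S₀ : Finset (Fin N)} {η : ℝ}
    {x : Fin N → Bool} : x ∈ parityClass g S₀ η ↔ sgn (g x) = η * walsh S₀ x := by
  simp [parityClass]

/-- **Edges inside a parity class are sensitive**: "any edge in the hypercube that goes between
`V₀` and `V₀` is an edge in `G_f` since it changes the value of `f`", and likewise for `V₁`.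
[cite: AaronsonBenDavidKothariRaoTal2021, §3 (proof of Thm. "Huang")] -/
theorem parityClass_sensitive {g : (Fin N → Bool) → Bool} {S₀ : Finset (Fin N)} {η : ℝ}
    (hη : η ≠ 0) {i : Fin N} (hi : i ∈ S₀) {x : Fin N → Bool} (hx : x ∈ parityClass g S₀ η)
    (hxi : flipBlock x {i} ∈ parityClass g S₀ η) : g x ≠ g (flipBlock x {i}) := by
  intro heq
  rw [mem_parityClass] at hx hxi
  rw [walsh_flipBlock_singleton_of_mem hi, ← heq, hx] at hxi
  have hw : walsh S₀ x ≠ 0 := fun h => by simpa [h] using abs_walsh S₀ x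
  have : (2 * η) * walsh S₀ x = 0 := by linarith
  rcases mul_eq_zero.mp this with h | h
  · exact hη (by linarith)
  · exact hw h

/-- `|V₁| - |V₋₁| = ∑_x (-1)^{g(x)} χ_{S₀}(x)`. [cite: AaronsonBenDavidKothariRaoTal2021, §3 (proof
of Thm. "Huang": "`f`'s top Fourier coefficient")] -/
theorem card_parityClass_sub (g : (Fin N → Bool) → Bool) (S₀ : Finset (Fin N)) :
    ((parityClass g S₀ 1).card : ℝ) - (parityClass g S₀ (-1)).card =
      ∑ x, sgn (g x) * walsh S₀ x := by
  unfold parityClass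
  rw [Finset.natCast_card_filter, Finset.natCast_card_filter, ← Finset.sum_sub_distrib]
  refine Finset.sum_congr rfl fun x _ => ?_
  have hw : walsh S₀ x = 1 ∨ walsh S₀ x = -1 := by
    have := abs_walsh S₀ x
    rcases le_or_gt 0 (walsh S₀ x) with h | h
    · left; rwa [abs_of_nonneg h] at this
    · right; rw [abs_of_neg h] at this; linarith
  rcases hw with h | h <;> cases g x <;> norm_num [h, sgn]

/-- `|V₁| + |V₋₁| = 2ᴺ`: every point lies in exactly one class. [folklore] -/
theorem card_parityClass_add (g : (Fin N → Bool) → Bool) (S₀ : Finset (Fin N)) :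
    (parityClass g S₀ 1).card + (parityClass g S₀ (-1)).card = 2 ^ N := by
  have h : ((parityClass g S₀ 1).card : ℝ) + (parityClass g S₀ (-1)).card = 2 ^ N := by
    unfold parityClass
    rw [Finset.natCast_card_filter, Finset.natCast_card_filter, ← Finset.sum_add_distrib]
    have hw : ∀ x : Fin N → Bool, walsh S₀ x = 1 ∨ walsh S₀ x = -1 := by
      intro x
      have := abs_walsh S₀ x
      rcases le_or_gt 0 (walsh S₀ x) with h | h
      · left; rwa [abs_of_nonneg h] at this
      · right; rw [abs_of_neg h] at this; linarith
    rw [Finset.sum_congr rfl (g := fun _ => (1 : ℝ))]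
    · simp
    · intro x _
      rcases hw x with h | h <;> cases g x <;> norm_num [h, sgn]
  exact_mod_cast h

/-- **`|V₀| ≠ |V₁|` from a nonzero coefficient at `S₀`**: `∑_x (-1)^{g(x)} χ_{S₀}(x) =
-2^{N+1} ĝ(S₀)` for `S₀ ≠ ∅` (with `ĝ` the coefficient of the `0/1`-valued `g`). [cite:
AaronsonBenDavidKothariRaoTal2021, §3 (proof of Thm. "Huang")] -/
theorem sum_sgn_mul_walsh (g : (Fin N → Bool) → Bool) {S₀ : Finset (Fin N)} (hS : S₀.Nonempty) :
    ∑ x, sgn (g x) * walsh S₀ x = -(2 * 2 ^ N * cubeFourierCoeff (realOf g) S₀) := by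
  have h2 : (2 : ℝ) ^ N ≠ 0 := by positivity
  unfold cubeFourierCoeff
  rw [show (2 : ℝ) * 2 ^ N * ((∑ x, realOf g x * walsh S₀ x) / 2 ^ N) =
      2 * ∑ x, realOf g x * walsh S₀ x by field_simp]
  rw [Finset.mul_sum, ← Finset.sum_neg_distrib]
  have hsplit : ∀ x, sgn (g x) * walsh S₀ x =
      walsh S₀ x + -(2 * (realOf g x * walsh S₀ x)) := by
    intro x
    rw [realOf_apply]
    cases g x
    · norm_num [sgn]
    · norm_num [sgn]; ring
  rw [Finset.sum_congr rfl fun x _ => hsplit x, Finset.sum_add_distrib,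
    sum_walsh_eq_zero_of_nonempty hS, zero_add]

/-- **The larger class exceeds half the cube** when `ĝ(S₀) ≠ 0`, `S₀ ≠ ∅` ("Assume without loss
of generality that `|V₀| > |V₁|`. Thus, `|V₀| ≥ 2^{n-1} + 1`"). [cite:
AaronsonBenDavidKothariRaoTal2021, §3 (proof of Thm. "Huang")] -/
theorem exists_large_parityClass (g : (Fin N → Bool) → Bool) {S₀ : Finset (Fin N)}
    (hS : S₀.Nonempty) (hcoef : cubeFourierCoeff (realOf g) S₀ ≠ 0) :
    ∃ η : ℝ, η ≠ 0 ∧ 2 ^ (N - 1) < (parityClass g S₀ η).card := by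
  have hN : 1 ≤ N := by
    obtain ⟨i, -⟩ := hS
    exact i.pos
  have hadd := card_parityClass_add g S₀
  have hsub := card_parityClass_sub g S₀
  rw [sum_sgn_mul_walsh g hS] at hsub
  have hne : (parityClass g S₀ 1).card ≠ (parityClass g S₀ (-1)).card := by
    intro h
    rw [h, sub_self] at hsub
    have : (2 : ℝ) * 2 ^ N * cubeFourierCoeff (realOf g) S₀ = 0 := by linarith
    simp [hcoef] at this
  have h2 : 2 ^ N = 2 * 2 ^ (N - 1) := by
    rw [← pow_succ']; congr 1; omega
  rcases lt_or_gt_of_ne hne with h | h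
  · exact ⟨-1, by norm_num, by omega⟩
  · exact ⟨1, by norm_num, by omega⟩

/-! ### Restriction to a subcube and transport -/

/-- Transport of a vector `v` to the subcube `C = {x : x|_J = σ}` along `x ↦ x|_{J ← τ}`:
`u(x) = v(x|_{J ← τ})` on `C`, `0` off `C`. [cite: AaronsonBenDavidKothariRaoTal2021, §3 (proof of
Thm. "Huang": restriction to a subcube)] -/
def transportVec (J : Finset (Fin N)) (σ τ : Fin N → Bool) (v : (Fin N → Bool) → ℝ)
    (x : Fin N → Bool) : ℝ :=
  if J.piecewise σ x = x then v (J.piecewise τ x) else 0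

end Huang

/-! ### The pointwise eigen-inequality -/

open Huang in
/-- **Huang's theorem as a pointwise certificate** (ABKRT's form of `deg(f) ≤ λ(f)²`): there is
a nonnegative unit vector `δ` on the cube with `√deg(f) · δ_x ≤ ∑_{i : f(x) ≠ f(x^i)} δ_{x^i}` for
every `x`, i.e. `(A_f δ)_x ≥ √deg(f) · δ_x`. [cite: AaronsonBenDavidKothariRaoTal2021, Thm. "Huang"
(§1, §3)] [cite: Huang2019, Thm. 1.1] -/
theorem huang_degree_pointwise (f : (Fin N → Bool) → Bool) :
    ∃ δ : (Fin N → Bool) → ℝ, (∀ x, 0 ≤ δ x) ∧ ∑ x, δ x ^ 2 = 1 ∧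
      ∀ x, Real.sqrt (booleanDegree f) * δ x ≤
        ∑ i, if f x = f (flipBlock x {i}) then 0 else δ (flipBlock x {i}) := by
  classical
  rcases Nat.eq_zero_or_pos (booleanDegree f) with hd | hd
  · -- degree `0`: any unit indicator vector will do
    set δ₀ : (Fin N → Bool) → ℝ := fun x => if x = fun _ => false then 1 else 0 with hδ₀
    have hδ₀nn : ∀ y, 0 ≤ δ₀ y := fun y => by
      simp only [hδ₀]; split_ifs <;> norm_num
    refine ⟨δ₀, hδ₀nn, ?_, fun x => ?_⟩
    · simp [hδ₀, Finset.sum_ite_eq']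
    · rw [hd, Nat.cast_zero, Real.sqrt_zero, zero_mul]
      exact Finset.sum_nonneg fun i _ => by
        split_ifs
        · exact le_rfl
        · exact hδ₀nn _
  -- a maxonomial `S₀` and the restriction `f'`
  obtain ⟨S₀, hS, hcoef, hcard⟩ := exists_maxonomial_of_pos (g := realOf f) hd
  set J : Finset (Fin N) := Finset.univ \ S₀ with hJ
  have hdisj : Disjoint S₀ J := by rw [hJ]; exact Finset.disjoint_sdiff
  have hJmem : ∀ {i}, i ∈ S₀ → i ∉ J := fun hi hiJ => Finset.disjoint_left.mp hdisj hi hiJ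
  set σ : Fin N → Bool := fun _ => false with hσ
  set f' : (Fin N → Bool) → Bool := fun x => f (J.piecewise σ x) with hf'
  have hcoef' : cubeFourierCoeff (realOf f') S₀ ≠ 0 := by
    have := cubeFourierCoeff_piecewise_of_maxonomial (realOf f) hcard hdisj σ
    rw [← this] at hcoef
    exact hcoef
  -- the large parity class and Huang's eigenvector supported in it
  obtain ⟨η, hη, hbig⟩ := exists_large_parityClass f' hS hcoef'
  obtain ⟨v, hv0, hvsupp, hvB⟩ := exists_eigenvector_vanishing_off hS _ hbig
  obtain ⟨τ, hτ⟩ : ∃ τ, v τ ≠ 0 := by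
    by_contra h
    push Not at h
    exact hv0 (funext h)
  -- transport to the subcube `C = {x : x|_J = σ}`
  set u := transportVec J σ τ v with hu
  have hu_off : ∀ x, J.piecewise σ x ≠ x → u x = 0 := fun x hx => by
    simp [hu, transportVec, hx]
  have hu_on : ∀ x, J.piecewise σ x = x → u x = v (J.piecewise τ x) := fun x hx => by
    simp [hu, transportVec, hx]
  -- `u ≠ 0`
  have hux : u (J.piecewise σ τ) ≠ 0 := by
    rw [hu_on _ (Finset.piecewise_idem_right J σ σ τ), Finset.piecewise_idem_right, piecewise_self]
    exact hτ
  -- the unnormalised pointwise inequality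
  have hmain : ∀ x, Real.sqrt (booleanDegree f) * |u x| ≤
      ∑ i, if f x = f (flipBlock x {i}) then 0 else |u (flipBlock x {i})| := by
    intro x
    have hrhs : 0 ≤ ∑ i, if f x = f (flipBlock x {i}) then (0 : ℝ) else |u (flipBlock x {i})| :=
      Finset.sum_nonneg fun i _ => by split_ifs <;> positivity
    by_cases hx : u x = 0
    · rw [hx, abs_zero, mul_zero]; exact hrhs
    have hxC : J.piecewise σ x = x := by
      by_contra h; exact hx (hu_off x h)
    set x' := J.piecewise τ x with hx'
    have hux' : u x = v x' := hu_on x hxC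
    have hvx' : v x' ≠ 0 := by rwa [← hux']
    have hx'V : x' ∈ parityClass f' S₀ η := by
      by_contra h; exact hvx' (hvsupp x' h)
    -- the eigen-equation at `x'`
    have heig : Real.sqrt S₀.card * v x' = ∑ i ∈ S₀, huangSign S₀ x' i * v (flipBlock x' {i}) := by
      have := congrFun hvB x'
      simp only [Pi.smul_apply, smul_eq_mul] at this
      rw [← this, huangOp_apply]
    -- neighbours: `u (x^i) = v (x'^i)` for `i ∈ S₀`
    have hnb : ∀ i ∈ S₀, u (flipBlock x {i}) = v (flipBlock x' {i}) := by
      intro i hi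
      have hiJ : i ∉ J := hJmem hi
      have hC : J.piecewise σ (flipBlock x {i}) = flipBlock x {i} := by
        rw [piecewise_flipBlock_singleton hiJ, hxC]
      rw [hu_on _ hC, hx', piecewise_flipBlock_singleton hiJ]
    -- sensitive edges of `f'` at `x'` are sensitive edges of `f` at `x`
    have hfx : f' x' = f x := by
      simp only [hf', hx']
      rw [Finset.piecewise_idem_right, hxC]
    have hfxi : ∀ i ∈ S₀, f' (flipBlock x' {i}) = f (flipBlock x {i}) := by
      intro i hi
      have hiJ : i ∉ J := hJmem hi
      simp only [hf', hx']
      rw [← piecewise_flipBlock_singleton hiJ, Finset.piecewise_idem_right,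
        piecewise_flipBlock_singleton hiJ, hxC]
    calc Real.sqrt (booleanDegree f) * |u x|
        = |∑ i ∈ S₀, huangSign S₀ x' i * v (flipBlock x' {i})| := by
          rw [← heig, abs_mul, abs_of_nonneg (Real.sqrt_nonneg _), hux', booleanDegree, ← hcard]
      _ ≤ ∑ i ∈ S₀, |v (flipBlock x' {i})| := by
          refine (Finset.abs_sum_le_sum_abs _ _).trans (le_of_eq (Finset.sum_congr rfl ?_))
          intro i _
          rw [abs_mul, abs_huangSign, one_mul]
      _ ≤ ∑ i ∈ S₀, if f x = f (flipBlock x {i}) then 0 else |u (flipBlock x {i})| := by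
          refine Finset.sum_le_sum fun i hi => ?_
          rw [← hnb i hi]
          by_cases hui : u (flipBlock x {i}) = 0
          · rw [hui, abs_zero]; split_ifs <;> positivity
          · have hvi : v (flipBlock x' {i}) ≠ 0 := by rwa [← hnb i hi]
            have hiV : flipBlock x' {i} ∈ parityClass f' S₀ η := by
              by_contra h; exact hvi (hvsupp _ h)
            have hsens := parityClass_sensitive hη hi hx'V hiV
            rw [hfx, hfxi i hi] at hsens
            rw [if_neg hsens]
      _ ≤ ∑ i, if f x = f (flipBlock x {i}) then 0 else |u (flipBlock x {i})| :=
          Finset.sum_le_univ_sum_of_nonneg fun i => by split_ifs <;> positivity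
  -- normalise
  set Z := ∑ x, u x ^ 2 with hZ
  have hZpos : 0 < Z := by
    rw [hZ]
    exact lt_of_lt_of_le (by positivity) (Finset.single_le_sum (f := fun x => u x ^ 2)
      (fun x _ => sq_nonneg _) (Finset.mem_univ (J.piecewise σ τ)))
  have hZs : 0 < Real.sqrt Z := Real.sqrt_pos.mpr hZpos
  refine ⟨fun x => |u x| / Real.sqrt Z, fun x => by positivity, ?_, fun x => ?_⟩
  · simp_rw [div_pow, sq_abs, ← Finset.sum_div, Real.sq_sqrt hZpos.le]
    exact div_self hZpos.ne'
  · have h := div_le_div_of_nonneg_right (hmain x) hZs.le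
    rw [Finset.sum_div] at h
    refine le_trans (le_of_eq (by ring)) (h.trans (le_of_eq (Finset.sum_congr rfl fun i _ => ?_)))
    split_ifs <;> simp

end Literature.Computability.Complexity

end
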